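import Literature.AlgebraicGeometry.Motives.WeilJacobianDimension
import Literature.AlgebraicGeometry.Motives.SymmetricPowerSplitDivisors
import Literature.AlgebraicGeometry.Motives.CartierDivisorCurveDegree
import HarnessLib

/-!
# Abel's theorem on Weil's Jacobian: `∏_P f(P)^{ord_P(h)} = 1` for every rational function `h`

Layer `Literature/AlgebraicGeometry/Motives`, namespace `Literature.AlgebraicGeometry.Motives.WeilJacobian` (Weil's construction
of the Jacobian of a smooth projective curve `C` over an algebraically closed field `K` of characteristic `0`:
`Motives/WeilJacobianGlue`, `…Symmetrize`, `…Group`, `…Dimension` — the abelian variety `Jac`, the map `f = fJ : C → Jac`,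
`Q ↦ [Q − R₀(j₀)]`, and the INJECTIVE class map `clsX : Jac(K) → Cl(C_K)` with `clsX (f Q) = [Q − R₀(j₀)]`).  THEOREMS ONLY.

For a Cartier divisor `E` on `C` consider the (finite) product of `K`-points of `Jac`
`Π(E) := ∏_{P ∈ C(K)} f(P)^{ord_P E}` — Milne, *Jacobian Varieties* §5/§7: the divisor `Σ nᵢ Pᵢ` is sent to
`Σ nᵢ f(Pᵢ)`; it is the Abel–Jacobi sum `aj_{R₀(j₀)}(E)` of `Motives/JacobianAbelJacobiSum` read on Weil's model.  Proved here:

* §1 **`clsX (Π(E)) = [Σ_P ord_P(E)·([P] − [R₀ j₀])]`** (`clsX_prod_fJ_zpow`): the class of the product is the class of the divisor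
  (finite-product bookkeeping over `clsX_mul`, `clsX_inv`, `clsX_one`, `clsX_comp_fJ`; no function-field transport);
* §2 the transport of a principal divisor of `C` to the curve `C_K = C ×_K Spec K` on which Weil's classes live:
  **`Σ_P ord_P(h)·[P] = (h_K)`** (`sum_ordAt_principal_smul_ptDiv`), `h_K` the image of `h` in `K(C_K)` under the isomorphism
  `C_K ≅ C` (orders of vanishing are invariant under isomorphisms, `Scheme.ord_functionFieldMap_of_isIso`; every place of
  `K(C_K)/K` is a `K`-point, `CurvePlaces.exists_place_ratPtPoint_eq`); hence `Σ_P ord_P(h) = 0` (`sum_ordAt_principal_eq_zero`,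
  Stichtenoth Cor. 1.4.12 `deg (x) = 0`);
* §3 **ABEL'S THEOREM on Weil's Jacobian**: `Π(div h) = 1` (`prod_fJ_zpow_ordAt_principal_eq_one`, `finprod_…`): its class is
  `[(h_K)] = 0` and `clsX` is injective (`clsX_injective`).  Milne, *Jacobian Varieties* Thm. 1.1/§7 (`J(K) = Pic⁰(C)`);
  Lange, *Abelian Varieties over the Complex Numbers* §4.1.3 Thm. 4.1.4 («by a theorem of Abel its kernel is the subgroup of
  principal divisors»).

No definition, no named fact, no instance.  Use (cell `hodgecm-mathlib`, D-0151, road G4 letter (g4-1d) ABEL, road (W) «Weil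
transport»): with a homomorphism `v : Jac → 𝒥.J` carrying `f` to the Abel–Jacobi map of an arbitrary Jacobian `𝒥` (Weil's `Jac` has
the universal property — sibling leaf (W1)), this gives `𝒥.ajSum c (div h) = 1` (sequel (W3b)).  HC_CM is proved only modulo the 7
printed citations until rung 0 closes; this file moves no book.

## References
* [Milne1986JacobianVarieties] J. S. Milne, *Jacobian Varieties*, in Cornell–Silverman (eds.), *Arithmetic Geometry* (1986),
  Thm. 1.1, §5 (the maps `f^r`), §7 Thm. 7.1.
* [Lange2023AbelianVarietiesComplex] H. Lange, *Abelian Varieties over the Complex Numbers* (2023), §4.1.3 Thm. 4.1.4 (p. 206).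
* [Stichtenoth2009] H. Stichtenoth, *Algebraic Function Fields and Codes*, 2nd ed. (2009), Def. 1.4.2, Cor. 1.4.12.
-/

set_option autoImplicit false

noncomputable section

universe u

open CategoryTheory CategoryTheory.Limits AlgebraicGeometry MonoidalCategory CartesianMonoidalCategory MonObj
open Literature.NumberTheory.DiophantineGeometry
open Literature.NumberTheory.DiophantineGeometry.AlgFunctionField
open Literature.AlgebraicGeometry.RelativeSpec

namespace Literature.AlgebraicGeometry.Motives

open RatFn FieldPoint CartierDivisor CurvePlaces

namespace WeilJacobian

variable {K : Type u} [Field K] [IsAlgClosed K] [CharZero K]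
  (C : SchemeOver K) [IsIntegral C.left] [SmoothOfRelativeDimension 1 C.hom] [IsProper C.hom]
  [GeometricallyIntegral C.hom] (hC : IsProjectiveOver C) (hX : CechPseudoCoherentAt C) (g : ℕ)
  (hg : (genus K (curveBC C (strPt (K := K) K)).left.functionField : ℤ) ≤ g)
  (hW : (chartW C g hC).Nonempty) (j₀ : Fin g)

/-! ## §1 The class of a product of powers of `f`-values -/

/-- `clsX (a ^ n) = n • clsX a` for integers `n` (`clsX` is a homomorphism: `clsX_mul`, `clsX_inv`, `clsX_one`).
[cite: Milne1986JacobianVarieties, §7 Thm. 7.1 (Weil's construction)] -/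
theorem clsX_zpow (a : specOver K K ⟶ (Jac C hC hX g hg hW).X) (n : ℤ) :
    clsX C hC hX g hg hW (a ^ n) = n • clsX C hC hX g hg hW a := by
  induction n using Int.induction_on with
  | zero => rw [zpow_zero, clsX_one, zero_zsmul]
  | succ n ih => rw [zpow_add_one, clsX_mul, ih, add_zsmul, one_zsmul]
  | pred n ih => rw [zpow_sub_one, clsX_mul, clsX_inv, ih, sub_zsmul, one_zsmul]

/-- **`clsX (∏_{P ∈ s} f(P)^{n_P}) = [Σ_{P ∈ s} n_P·([P] − [R₀ j₀])]`** — the class of a product of powers of values of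
`f : C → Jac` is the class of the corresponding divisor (Milne §5: `Σ nᵢ Pᵢ ↦ Σ nᵢ f(Pᵢ)`).
[cite: Milne1986JacobianVarieties, §5 (the maps f^r) and §7 (the map C → J)] -/
theorem clsX_prod_fJ_zpow (s : Finset (AlgPoints C K)) (n : AlgPoints C K → ℤ) :
    clsX C hC hX g hg hW (∏ P ∈ s, (AlgPoints.map (fJ C hC hX g hg hW j₀) P) ^ (n P)) =
      DivisorClass.mk (∑ P ∈ s, n P • (ptDiv C P - ptDiv C (baseTuple C hC hX g hW j₀))) := by
  classical
  induction s using Finset.induction_on with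
  | empty => rw [Finset.prod_empty, Finset.sum_empty, clsX_one]; rfl
  | insert P s hP ih =>
    rw [Finset.prod_insert hP, Finset.sum_insert hP, clsX_mul, ih, clsX_zpow, AlgPoints.map_apply, clsX_comp_fJ]
    rfl

/-! ## §2 Transport of a principal divisor of `C` to the curve `C_K` -/

omit [IsAlgClosed K] [CharZero K] [IsIntegral C.left] [SmoothOfRelativeDimension 1 C.hom] [IsProper C.hom]
  [GeometricallyIntegral C.hom] in
/-- The first projection `C_K = C ×_K Spec K → C` is an isomorphism. [folklore] -/
private theorem isIso_fieldPointFst : IsIso (fieldPointFst C (strPt (K := K) K)) := by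
  haveI : IsIso (strPt (K := K) K) := by rw [strPt_self]; infer_instance
  change IsIso (pullback.fst C.hom (strPt (K := K) K))
  infer_instance

omit [IsAlgClosed K] [CharZero K] [IsIntegral C.left] [SmoothOfRelativeDimension 1 C.hom] [IsProper C.hom]
  [GeometricallyIntegral C.hom] in
/-- The projection sends the rational point of `C_K` attached to `Q ∈ C(K)` to the point of `C` underlying `Q`. [folklore] -/
private theorem fieldPointFst_ratPtPoint_eq_pt (Q : AlgPoints C K) :
    fieldPointFst C (strPt (K := K) K) (ratPtPoint C _ Q) = Q.pt :=
  fieldPointFst_ratPtPoint C _ Q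

omit [IsAlgClosed K] [CharZero K] in
/-- **Orders of vanishing transported to `C_K`**: for `h ∈ K(C)^×` and `Q ∈ C(K)`, the image `h_K` of `h` in `K(C_K)` has
`ord_{Q_K}(h_K) = ord_Q(h)` at the rational point `Q_K` of `C_K` attached to `Q` (orders of vanishing are invariant under the
isomorphism `C_K ≅ C`, `Scheme.ord_functionFieldMap_of_isIso`). [cite: Hartshorne1977, II.6 (before Lemma 6.5)] -/
theorem ord_functionFieldMap_fieldPointFst_ratPtPoint {h : C.left.functionField} (hh : h ≠ 0) (Q : AlgPoints C K) :
    haveI := isIso_fieldPointFst C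
    Scheme.ord (functionFieldMap (fieldPointFst C (strPt (K := K) K)) h) (ratPtPoint C _ Q) = Scheme.ord h Q.pt := by
  haveI := isIso_fieldPointFst C
  haveI := isDiscreteValuationRing_stalk (curveBC C (strPt (K := K) K)) (ratPtPoint_ne_genericPoint C _ Q)
  have hQ : Q.pt ≠ genericPoint C.left := by
    intro hgen
    have h1 := ratPtPoint_ne_genericPoint C (strPt (K := K) K) Q
    apply h1
    have hiso := fieldPointFst_ratPtPoint_eq_pt C Q
    rw [hgen] at hiso
    -- an isomorphism maps only the generic point to the generic point
    have hinj : Function.Injective (fieldPointFst C (strPt (K := K) K)).base :=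
      (TopCat.homeoOfIso (Scheme.forgetToTop.mapIso (asIso (fieldPointFst C (strPt (K := K) K))))).injective
    apply hinj
    rw [hiso]
    exact (genericPoint_eq_of_isDominant (fieldPointFst C (strPt (K := K) K))).symm
  haveI := isDiscreteValuationRing_stalk C hQ
  haveI : IsDiscreteValuationRing (C.left.presheaf.stalk ((fieldPointFst C (strPt (K := K) K)) (ratPtPoint C _ Q))) := by
    rw [fieldPointFst_ratPtPoint_eq_pt]; infer_instance
  rw [Scheme.ord_functionFieldMap_of_isIso (fieldPointFst C (strPt (K := K) K)) (ratPtPoint C _ Q) hh,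
    fieldPointFst_ratPtPoint_eq_pt]

omit [CharZero K] in
/-- **`Σ_P ord_P(h)·[P] = (h_K)`**: the divisor of `K(C_K)/K` with coefficient `ord_P(h)` at (the place of) each rational point
`P` of `C` is the principal divisor of the transported function `h_K` — both have coefficient `ord_P(h)` at the place of `P`
(`toDivisor_principal` on `C_K`), and every place of `K(C_K)/K` is the place of a rational point (`K` algebraically closed).
The sum is taken over any finite set `s` of rational points containing the support.
[cite: Stichtenoth2009, Def. 1.4.2] [cite: Hartshorne1977, II.6 (principal divisors on curves)] -/
theorem sum_ordAt_principal_smul_ptDiv {h : C.left.functionField} (hh : h ≠ 0) (s : Finset (AlgPoints C K))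
    (hs : ∀ P : AlgPoints C K, (CartierDivisor.principal h hh).ordAt P.pt ≠ 0 → P ∈ s) :
    haveI := isIso_fieldPointFst C
    ∑ P ∈ s, (CartierDivisor.principal h hh).ordAt P.pt • ptDiv C P =
      (principalDivisor K (functionFieldMap (fieldPointFst C (strPt (K := K) K)) h) :
        Divisor K (curveBC C (strPt (K := K) K)).left.functionField) := by
  classical
  haveI := isIso_fieldPointFst C
  have hh' : (functionFieldMap (fieldPointFst C (strPt (K := K) K)) h : (curveBC C (strPt (K := K) K)).left.functionField) ≠ 0 :=
    (map_ne_zero (functionFieldMap (fieldPointFst C (strPt (K := K) K)))).mpr hh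
  -- compare coefficients at every place `v`; every place is the place of a rational point `Q`
  rw [← toDivisor_principal (curveBC C (strPt (K := K) K)) hh']
  ext v
  obtain ⟨Q, rfl⟩ := exists_place_ratPtPoint_eq C v
  have hord : Scheme.ord (functionFieldMap (fieldPointFst C (strPt (K := K) K)) h :
      (curveBC C (strPt (K := K) K)).left.functionField) (ratPtPoint C _ Q) = Scheme.ord h Q.pt :=
    ord_functionFieldMap_fieldPointFst_ratPtPoint C hh Q
  rw [toDivisor_place, CartierDivisor.ordAt_principal]
  refine Eq.trans ?_ hord.symm
  rw [← CartierDivisor.ordAt_principal hh, Finset.sum_apply']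
  -- the sum has a single non-zero term, at `P = Q`
  have hsingle : ∀ P : AlgPoints C K, ((CartierDivisor.principal h hh).ordAt P.pt • ptDiv C P)
      (place (curveBC C (strPt (K := K) K)) (ratPtPoint C _ Q) (ratPtPoint_ne_genericPoint C _ Q)) =
      if P = Q then (CartierDivisor.principal h hh).ordAt Q.pt else 0 := by
    intro P
    rw [Finsupp.smul_apply, ptDiv, Finsupp.single_apply]
    by_cases hPQ : P = Q
    · subst hPQ; simp
    · have hne : place (curveBC C (strPt (K := K) K)) (ratPtPoint C _ P) (ratPtPoint_ne_genericPoint C _ P) ≠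
          place (curveBC C (strPt (K := K) K)) (ratPtPoint C _ Q) (ratPtPoint_ne_genericPoint C _ Q) := by
        intro hpl
        apply hPQ
        have hpt := place_injective _ _ hpl
        exact ratPtPoint_injective C (strPt (K := K) K) hpt
      rw [if_neg hne, if_neg hPQ, smul_zero]
  simp_rw [hsingle]
  rw [Finset.sum_ite_eq' s Q]
  split_ifs with hQs
  · rfl
  · -- `Q ∉ s`, so `ord_Q(h) = 0`
    by_contra hne
    exact hQs (hs Q (fun h0 => hne (h0.symm)))

omit [CharZero K] in
/-- **`Σ_P ord_P(h) = 0`** over the rational points of `C` (the principal divisor `(h_K)` has degree `0`, Stichtenoth Cor. 1.4.12,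
and each `[P]` has degree `1`). [cite: Stichtenoth2009, Cor. 1.4.12] -/
theorem sum_ordAt_principal_eq_zero {h : C.left.functionField} (hh : h ≠ 0) (s : Finset (AlgPoints C K))
    (hs : ∀ P : AlgPoints C K, (CartierDivisor.principal h hh).ordAt P.pt ≠ 0 → P ∈ s) :
    ∑ P ∈ s, (CartierDivisor.principal h hh).ordAt P.pt = 0 := by
  haveI := isIso_fieldPointFst C
  have hh' : (functionFieldMap (fieldPointFst C (strPt (K := K) K)) h : (curveBC C (strPt (K := K) K)).left.functionField) ≠ 0 :=
    (map_ne_zero (functionFieldMap (fieldPointFst C (strPt (K := K) K)))).mpr hh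
  have h0 : Divisor.degree (principalDivisor K (functionFieldMap (fieldPointFst C (strPt (K := K) K)) h) :
      Divisor K (curveBC C (strPt (K := K) K)).left.functionField) = 0 :=
    degree_principalDivisor_eq_zero hh'
  have hdeg := congrArg (Divisor.degree : Divisor K (curveBC C (strPt (K := K) K)).left.functionField →+ ℤ)
    (sum_ordAt_principal_smul_ptDiv C hh s hs)
  rw [map_sum] at hdeg
  simp only [Finsupp.smul_single, smul_eq_mul, Divisor.degree_single,
    PlaceOver.degree_eq_one_of_isAlgClosed', Nat.cast_one] at hdeg
  norm_num at hdeg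
  simp only [CartierDivisor.ordAt_principal]
  rw [hdeg]
  exact h0

/-! ## §3 Abel's theorem on Weil's Jacobian -/

/-- **ABEL'S THEOREM (Weil's model), finite-product form**: for `h ∈ K(C)^×` and any finite set `s` of rational points containing the
support of `div h`, `∏_{P ∈ s} f(P)^{ord_P(h)} = 1` in `Jac(K)` — its class is `[Σ_P ord_P(h)·([P] − [R₀ j₀])] = [(h_K)] − 0·[R₀ j₀] = 0`
and `clsX` is injective.  [cite: Milne1986JacobianVarieties, Thm. 1.1 and §7 Thm. 7.1] [cite: Lange2023AbelianVarietiesComplex, §4.1.3 Thm. 4.1.4 (p. 206)] -/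
theorem prod_fJ_zpow_ordAt_principal_eq_one {h : C.left.functionField} (hh : h ≠ 0) (s : Finset (AlgPoints C K))
    (hs : ∀ P : AlgPoints C K, (CartierDivisor.principal h hh).ordAt P.pt ≠ 0 → P ∈ s) :
    ∏ P ∈ s, (AlgPoints.map (fJ C hC hX g hg hW j₀) P) ^ ((CartierDivisor.principal h hh).ordAt P.pt) = 1 := by
  classical
  haveI := isIso_fieldPointFst C
  apply clsX_injective C hC hX g hg hW
  rw [clsX_prod_fJ_zpow, clsX_one]
  have hsplit : ∑ P ∈ s, (CartierDivisor.principal h hh).ordAt P.pt • (ptDiv C P - ptDiv C (baseTuple C hC hX g hW j₀)) =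
      ∑ P ∈ s, (CartierDivisor.principal h hh).ordAt P.pt • ptDiv C P -
        (∑ P ∈ s, (CartierDivisor.principal h hh).ordAt P.pt) • ptDiv C (baseTuple C hC hX g hW j₀) := by
    rw [Finset.sum_smul, ← Finset.sum_sub_distrib]
    refine Finset.sum_congr rfl fun P _ => ?_
    rw [smul_sub]
  rw [hsplit, sum_ordAt_principal_eq_zero C hh s hs, zero_zsmul, sub_zero,
    sum_ordAt_principal_smul_ptDiv C hh s hs]
  -- the class of a principal divisor is `0`
  have hh' : (functionFieldMap (fieldPointFst C (strPt (K := K) K)) h : (curveBC C (strPt (K := K) K)).left.functionField) ≠ 0 :=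
    (map_ne_zero (functionFieldMap (fieldPointFst C (strPt (K := K) K)))).mpr hh
  rw [DivisorClass.mk, QuotientAddGroup.eq_zero_iff]
  exact AddSubgroup.subset_closure ⟨_, hh', rfl⟩

/-- **ABEL'S THEOREM (Weil's model)**: `∏_{P ∈ C(K)} f(P)^{ord_P(h)} = 1` for every `h ∈ K(C)^×` (the product is finite: the support
of `div h` is finite and rational points are determined by their underlying points).
[cite: Milne1986JacobianVarieties, Thm. 1.1 and §7 Thm. 7.1] [cite: Lange2023AbelianVarietiesComplex, §4.1.3 Thm. 4.1.4 (p. 206)] -/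
theorem finprod_fJ_zpow_ordAt_principal_eq_one {h : C.left.functionField} (hh : h ≠ 0) :
    ∏ᶠ P : AlgPoints C K, (AlgPoints.map (fJ C hC hX g hg hW j₀) P) ^ ((CartierDivisor.principal h hh).ordAt P.pt) = 1 := by
  classical
  -- the support is finite
  have hfin : {P : AlgPoints C K | (CartierDivisor.principal h hh).ordAt P.pt ≠ 0}.Finite := by
    have hcyc := (CartierDivisor.principal h hh).finite_support_cycle (C := C)
    refine (hcyc.preimage (f := fun P : AlgPoints C K => P.pt) ?_).subset ?_
    · exact fun P _ Q _ hPQ => AlgPoints.eq_of_pt_eq hPQ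
    · intro P hP
      simpa [Function.mem_support, CartierDivisor.cycle_apply] using hP
  rw [finprod_eq_prod_of_mulSupport_subset _ (s := hfin.toFinset) ?_]
  · exact prod_fJ_zpow_ordAt_principal_eq_one C hC hX g hg hW j₀ hh hfin.toFinset
      (fun P hP => hfin.mem_toFinset.mpr hP)
  · intro P hP
    simp only [Function.mem_mulSupport] at hP
    refine Finset.mem_coe.mpr (hfin.mem_toFinset.mpr ?_)
    intro h0
    exact hP (by rw [h0, zpow_zero])

end WeilJacobian

end Literature.AlgebraicGeometry.Motives

end
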